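import Summits.ValiantsHypothesis.ValiantsHypothesis.Theorems.LacunarySymmetroidMatrixDescartesVSQTriPoints1
import Summits.ValiantsHypothesis.ValiantsHypothesis.Theorems.LacunarySymmetroidMatrixDescartesVSQLaw
import Summits.ValiantsHypothesis.ValiantsHypothesis.Theorems.KPlusLogSqLawRailLaw

/-!
# `MatrixDescartes` census — the ALL-`K` law of the `m = 3` row: `ζ_sym(3,K) ≥ 7K − 13` for every `K ≥ 4`, and the RAIL FLOOR
# `RailFloorThree` (`ζ_sym(3,K) ≥ 6K − 9` for every `K ≥ 3`) PROVED

HONEST FRAMING.  Val-V1-extremal engine seat val-v1x-eng-6 (g2), `--supports stmt-ValiantsHypothesis-18050`.  This file proves, for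
EVERY `K ≥ 4`, `¬ PosRootLawAt 3 K (7K − 14)` (`tri_law_three`): the explicit real symmetric tridiagonal `3 × 3` pencil
`letters3 (K−2) (16K²)` (`…VSQTriDefs`) has at least `7K − 13` distinct positive determinant zeros — slope `7` per exponent for all
`K` at `m = 3` (the kernel's chain rays give `≤ 27/4`).  COROLLARY: the cell conjecture `KPlusLogSqLaw.RailLaw.RailFloorThree`
(`∀ K ≥ 3, ¬ PosRootLawAt 3 K (6K − 10)`, pub-symmetroid theory-2 g19 / typer g11, kernel evidence `K ≤ 10` only,
`railFloorThree_upto_ten`) now HOLDS for every `K` (`railFloorThree_holds`): `K = 3` from the census row `(3,3) = 9`, `K ≥ 4`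
from `7K − 14 ≥ 6K − 10`.  A fixed-`m`, all-`K` LOWER bound bears on the crux `MatrixDescartes` (stmt-18050: an UPPER bound
`2^{C K log K}` in the window `m ≤ 2^{polylog K}`) neither way; `VP ≠ VNP` is NOT proved; whether `ζ_sym(3,K) − 7K` is bounded is open.

MECHANISM (tridiagonal «Viro patchworking + square splitting», three levels `σ = 4K − 4` apart in `x = log_B t`): level `0` — the
`a`-chain of `P₀` (`K − 1` signs), the crossing `P₀P₁ = Q₀²`, the `K − 3` sign changes of `Q₀` each SPLIT into two zeros
(`det = P₀(P₁P₂ − Q₁²) > 0` at the zero of `Q₀`, `< 0` around it), the crossing back; level `1` — the same for `P₁, Q₁` while `P₀`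
sits on its far top term `t^{K²+K−6}`; level `2` — the `c`-chain of `P₂` (`K` signs).  `(K−1) + (2K−5) + 1 + (K−2) + (2K−5) + 1 +
K − 1 = 7K − 13` alternations at the `7K − 12` points `tau3` (`le_card_posRoots_of_alternating`, tree).
[folklore] Viro patchworking / dominance; intermediate value theorem.
-/

set_option linter.dupNamespace false
set_option autoImplicit false

namespace Summit.ValiantsHypothesis.ValiantsHypothesis.Theorems.LacunarySymmetroidMatrixDescartes.VSQ

open scoped BigOperators
open Finset Polynomial
open Summit.ValiantsHypothesis.ValiantsHypothesis.Theorems.MatrixDescartes.Negative (PosRootLawAt)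
open Summit.ValiantsHypothesis.ValiantsHypothesis.Theorems.SymmetroidDescartes (le_card_posRoots_of_alternating)

variable {n : ℕ} {B : ℝ}

/-! ## 1. The pencil: symmetry and determinant -/

/-- the tridiagonal letters are symmetric. [folklore] -/
theorem letters3_isSymm (n : ℕ) (B : ℝ) (l : Fin (n + 2)) : (letters3 n B l).IsSymm := by
  unfold Matrix.IsSymm letters3
  ext i j
  fin_cases i <;> fin_cases j <;> rfl

/-- entries of the letters. [folklore] -/
theorem letters3_apply (n : ℕ) (B : ℝ) (l : Fin (n + 2)) :
    letters3 n B l 0 0 = saF n l * B ^ haF n l ∧ letters3 n B l 0 1 = sbF n l * B ^ (hbF n l - (dlt n : ℤ)) ∧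
    letters3 n B l 0 2 = 0 ∧ letters3 n B l 1 0 = sbF n l * B ^ (hbF n l - (dlt n : ℤ)) ∧
    letters3 n B l 1 1 = (-1) ^ n * saF n l * B ^ (haF n l - (sg n : ℤ) * (dF n l : ℤ)) ∧
    letters3 n B l 1 2 = sbF n l * B ^ (hbF n l - (sg n : ℤ) * (dF n l : ℤ)) ∧ letters3 n B l 2 0 = 0 ∧
    letters3 n B l 2 1 = sbF n l * B ^ (hbF n l - (sg n : ℤ) * (dF n l : ℤ)) ∧
    letters3 n B l 2 2 = (-1) ^ n * scF n l * B ^ (hcF n l - (sg n : ℤ) * (dF n l : ℤ)) :=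
  ⟨rfl, rfl, rfl, rfl, rfl, rfl, rfl, rfl, rfl⟩

/-- the pencil determinant evaluates to `E3`. [folklore] -/
theorem eval_det_letters3 (n : ℕ) {B : ℝ} (hB0 : B ≠ 0) (t : ℝ) :
    ((∑ l, (X : ℝ[X]) ^ dF n l • (letters3 n B l).map Polynomial.C).det).eval t = E3 n B t := by
  rw [Summit.ValiantsHypothesis.ValiantsHypothesis.Theorems.SymmetroidDescartes.eval_det_pencil, Matrix.det_fin_three]
  have h := fun l => letters3_apply n B l
  simp only [Matrix.sum_apply, Matrix.smul_apply, smul_eq_mul, (h _).1, (h _).2.1, (h _).2.2.1, (h _).2.2.2.1,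
    (h _).2.2.2.2.1, (h _).2.2.2.2.2.1, (h _).2.2.2.2.2.2.1, (h _).2.2.2.2.2.2.2.1, (h _).2.2.2.2.2.2.2.2, mul_zero,
    Finset.sum_const_zero]
  have e0 : ∑ l, t ^ dF n l * (saF n l * B ^ haF n l) = fa n B t := by
    unfold fa bnom tv; exact Finset.sum_congr rfl fun l _ => by ring
  have e1 : ∑ l, t ^ dF n l * (sbF n l * B ^ (hbF n l - (dlt n : ℤ))) = B ^ (-(dlt n : ℤ)) * fb n B t := by
    unfold fb; rw [← bnom_hconst hB0]; unfold bnom tv; exact Finset.sum_congr rfl fun l _ => by ring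
  have e2 : ∑ l, t ^ dF n l * ((-1) ^ n * saF n l * B ^ (haF n l - (sg n : ℤ) * (dF n l : ℤ))) =
      (-1) ^ n * fa n B (B ^ (-(sg n : ℤ)) * t) := by
    unfold fa; rw [← bnom_hshift hB0, ← bnom_smul]; unfold bnom tv; exact Finset.sum_congr rfl fun l _ => by ring
  have e3 : ∑ l, t ^ dF n l * (sbF n l * B ^ (hbF n l - (sg n : ℤ) * (dF n l : ℤ))) = fb n B (B ^ (-(sg n : ℤ)) * t) := by
    unfold fb; rw [← bnom_hshift hB0]; unfold bnom tv; exact Finset.sum_congr rfl fun l _ => by ring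
  have e4 : ∑ l, t ^ dF n l * ((-1) ^ n * scF n l * B ^ (hcF n l - (sg n : ℤ) * (dF n l : ℤ))) =
      (-1) ^ n * fc n B (B ^ (-(sg n : ℤ)) * t) := by
    unfold fc; rw [← bnom_hshift hB0, ← bnom_smul]; unfold bnom tv; exact Finset.sum_congr rfl fun l _ => by ring
  rw [e0, e1, e2, e3, e4]
  unfold E3
  ring

/-! ## 2. Signs at all `7n + 2` points -/

/-- `((−1)^n)² = 1`. [folklore] -/
theorem neg_one_pow_sq' (n : ℕ) : ((-1 : ℝ) ^ n) ^ 2 = 1 := by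
  rw [← pow_mul, mul_comm, pow_mul]; norm_num

/-- values of the signs used below. [folklore] -/
theorem sign_values (hn : 1 ≤ n) :
    saF n 0 = (-1) ^ n ∧ scF n 0 = 1 ∧ saF n (Fin.last (n + 1)) = 1 ∧ scF n (Fin.last (n + 1)) = (-1) ^ (n + 1) ∧
    saF n ⟨n, by omega⟩ = 1 := by
  refine ⟨?_, ?_, ?_, ?_, ?_⟩
  · show saR n 0 = _; rw [saR_zero]
  · show scR n 0 = _; rw [scR_zero]
  · show saR n (n + 1) = _; rw [saR_top]
  · show scR n (n + 1) = _; rw [scR_top]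
  · show saR n n = 1; rw [saR_blk hn le_rfl, ← two_mul, pow_mul]; norm_num

/-- the `m = 2` point `tau n B j` for `j < 3n`, made explicit. [folklore] -/
theorem tau_level (hn : 2 ≤ n) (j : ℕ) (hj : j < 3 * n) :
    (j ≤ n + 1 → tau n B j = B ^ (2 * (j : ℤ) - 1)) ∧
    (n + 1 < j → (j - n) % 2 = 0 → tau n B j = bz n B ((j - n) / 2)) ∧
    (n + 1 < j → (j - n) % 2 ≠ 0 → tau n B j = B ^ ((j : ℤ) + n)) := by
  unfold tau
  refine ⟨fun h => by rw [if_pos h], fun h hp => ?_, fun h hp => ?_⟩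
  · rw [if_neg (by omega), if_pos (by omega), if_pos hp]
  · rw [if_neg (by omega), if_pos (by omega), if_neg hp]

/-- `(−1)^j · E3 > 0` at the `j`-th level-`0` point `tau n B j`, `j < 3n`. [folklore] -/
theorem sign_tau3_L0 (hn : 2 ≤ n) (hB : 16 * ((n + 2 : ℕ) : ℝ) ^ 2 ≤ B) (j : ℕ) (hj : j < 3 * n) :
    0 < (-1 : ℝ) ^ j * E3 n B (tau n B j) := by
  obtain ⟨hB1, -, -⟩ := hB16 hB
  have hB0 : 0 < B := lt_trans zero_lt_one hB1
  obtain ⟨v1, v2, -, -, v5⟩ := sign_values (n := n) (by omega)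
  have hsq := neg_one_pow_sq' n
  obtain ⟨t1, t2, t3⟩ := tau_level (B := B) hn j hj
  by_cases hj1 : j ≤ n + 1
  · rw [t1 hj1]
    rcases Nat.eq_zero_or_pos j with h0 | hj0
    · subst h0
      have h := sign3_L0U hn hB (x := -1) (by linarith [(by exact_mod_cast hn : (2 : ℤ) ≤ n)]) 0
        (fun l hl => ea_low_dom hn (Nat.one_le_iff_ne_zero.2 fun h => hl (Fin.ext h)) (val_le l)) (gap0_low hn)
      rw [v1, v2] at h
      have e : ((-1 : ℝ) ^ n * ((-1) ^ n * (-1) ^ n) * ((-1) ^ n * 1)) = (((-1 : ℝ) ^ n) ^ 2) ^ 2 := by ring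
      rw [e, hsq] at h; simpa using h
    · by_cases hjn : j ≤ n
      · have h := sign3_L0U hn hB (x := 2 * (j : ℤ) - 1) (by linarith [(by exact_mod_cast hjn : (j : ℤ) ≤ n)])
          ⟨j, by omega⟩ (fun l hl => ea_blk_dom hn hj0 hjn (val_le l) (fun h => hl (Fin.ext h))) (gap0_blkA hj0 hjn)
        have vj : saF n ⟨j, by omega⟩ = (-1) ^ (n + j) := by show saR n j = _; rw [saR_blk hj0 hjn]
        rw [v1, v2, vj] at h
        have e : ((-1 : ℝ) ^ (n + j) * ((-1) ^ n * (-1) ^ n) * ((-1) ^ n * 1)) = (-1) ^ j * (((-1 : ℝ) ^ n) ^ 2) ^ 2 := by ring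
        rw [e, hsq] at h; simpa using h
      · have hj' : j = n + 1 := by omega
        subst hj'
        have h := sign3_L0W hn hB (w := 1) le_rfl (by omega)
        rw [v2] at h
        have e : (-1 : ℝ) ^ (n + 1) = -((-1) ^ n * 1) := by rw [pow_succ]; ring
        rw [e, show (2 * ((n + 1 : ℕ) : ℤ) - 1) = 2 * (n : ℤ) + 2 * (1 : ℕ) - 1 by push_cast; ring]
        exact h
  · by_cases hpar : (j - n) % 2 = 0
    · rw [t2 (by omega) hpar]
      obtain ⟨w, hw⟩ : ∃ w, j = n + 2 * w := ⟨(j - n) / 2, by omega⟩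
      rw [show (j - n) / 2 = w by omega]
      obtain ⟨b1, b2, b0⟩ := bz_spec (hB16 hB).2.2 (w := w) (by omega) (by omega)
      have h := sign3_L0I hn hB (w := w) (by omega) (by omega) b1.le b2.le b0
      rw [v1, v2, v5] at h
      have e : (-1 : ℝ) ^ j = 1 * ((-1) ^ n * (-1) ^ n) * ((-1) ^ n * 1) := by
        rw [hw, pow_add, pow_mul]
        rcases neg_one_pow_eq_or ℝ n with h1 | h1 <;> simp [h1]
      rw [e]; exact h
    · rw [t3 (by omega) hpar]
      obtain ⟨w, hw, hw2⟩ : ∃ w, j = n + 2 * w - 1 ∧ 2 ≤ w := ⟨(j - n + 1) / 2, by omega, by omega⟩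
      have h := sign3_L0W hn hB (w := w) (by omega) (by omega)
      rw [v2] at h
      have e : (-1 : ℝ) ^ j = -((-1) ^ n * 1) := by
        rw [show j = 2 * (w - 1) + (n + 1) by omega, pow_add, pow_mul, pow_add]
        rcases neg_one_pow_eq_or ℝ n with h1 | h1 <;> simp [h1]
      have e2 : ((j : ℤ) + n) = 2 * (n : ℤ) + 2 * w - 1 := by
        have : (j : ℤ) = n + 2 * w - 1 := by omega
        linarith
      rw [e, e2]; exact h

/-- `(−1)^j · E3 > 0` at the `j`-th level-`1` point `B^σ · tau n B j'`, `j = 3n + j'`, `j' < 3n`. [folklore] -/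
theorem sign_tau3_L1 (hn : 2 ≤ n) (hB : 16 * ((n + 2 : ℕ) : ℝ) ^ 2 ≤ B) (j' : ℕ) (hj : j' < 3 * n) :
    0 < (-1 : ℝ) ^ (3 * n + j') * E3 n B (B ^ (sg n : ℤ) * tau n B j') := by
  obtain ⟨hB1, -, -⟩ := hB16 hB
  have hB0 : 0 < B := lt_trans zero_lt_one hB1
  obtain ⟨v1, v2, v3, -, v5⟩ := sign_values (n := n) (by omega)
  have hsq := neg_one_pow_sq' n
  have h3n : (-1 : ℝ) ^ (3 * n + j') = (-1) ^ n * (-1) ^ j' := by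
    rw [pow_add, show 3 * n = 2 * n + n by ring, pow_add, pow_mul]; norm_num
  rw [h3n]
  obtain ⟨t1, t2, t3⟩ := tau_level (B := B) hn j' hj
  by_cases hj1 : j' ≤ n + 1
  · rw [t1 hj1, ← zpow_add₀ hB0.ne']
    rcases Nat.eq_zero_or_pos j' with h0 | hj0
    · subst h0
      have h := sign3_L1U hn hB (y := -1) le_rfl (by linarith [(by exact_mod_cast hn : (2 : ℤ) ≤ n)]) 0
        (fun l hl => ea_low_dom hn (Nat.one_le_iff_ne_zero.2 fun h => hl (Fin.ext h)) (val_le l))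
        (by show qa n ≤ ea n 0 (-1); rw [ea_zero]) (by show 2 * eb n 1 (-1) + 1 ≤ ea n 0 (-1) + ec n 0 (-1); exact gap_low hn)
      rw [v1, v2, v3] at h
      have e : (1 * ((-1 : ℝ) ^ n * (-1) ^ n) * ((-1) ^ n * 1)) = (-1) ^ n * (-1) ^ 0 * ((-1 : ℝ) ^ n) ^ 2 := by ring
      rw [e, hsq, mul_one] at h
      rw [show (2 * ((0 : ℕ) : ℤ) - 1) = (-1 : ℤ) by norm_num]
      exact h
    · by_cases hjn : j' ≤ n
      · have h := sign3_L1U hn hB (y := 2 * (j' : ℤ) - 1) (by linarith [(by exact_mod_cast hj0 : (1 : ℤ) ≤ j')])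
          (by linarith [(by exact_mod_cast hjn : (j' : ℤ) ≤ n)]) ⟨j', by omega⟩
          (fun l hl => ea_blk_dom hn hj0 hjn (val_le l) (fun h => hl (Fin.ext h)))
          (by have := qa_lt_ea_blk hn hj0 hjn; show qa n ≤ ea n j' _; linarith) (gap_blkA hj0 hjn)
        have vj : saF n ⟨j', by omega⟩ = (-1) ^ (n + j') := by show saR n j' = _; rw [saR_blk hj0 hjn]
        rw [v2, v3, vj] at h
        have e : (1 * ((-1 : ℝ) ^ n * (-1) ^ (n + j')) * ((-1) ^ n * 1)) = (-1) ^ n * (-1) ^ j' * ((-1 : ℝ) ^ n) ^ 2 := by ring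
        rw [e, hsq, mul_one] at h
        exact h
      · have hj'' : j' = n + 1 := by omega
        subst hj''
        have h := sign3_L1W hn hB (w := 1) le_rfl (by omega)
        rw [v3] at h
        have e : (-1 : ℝ) ^ n * (-1) ^ (n + 1) = -1 := by
          rcases neg_one_pow_eq_or ℝ n with h1 | h1 <;> simp [pow_succ, h1]
        rw [e, show (2 * ((n + 1 : ℕ) : ℤ) - 1) = 2 * (n : ℤ) + 2 * (1 : ℕ) - 1 by push_cast; ring]
        simpa using h
  · by_cases hpar : (j' - n) % 2 = 0
    · rw [t2 (by omega) hpar]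
      obtain ⟨w, hw⟩ : ∃ w, j' = n + 2 * w := ⟨(j' - n) / 2, by omega⟩
      rw [show (j' - n) / 2 = w by omega]
      obtain ⟨b1, b2, b0⟩ := bz_spec (hB16 hB).2.2 (w := w) (by omega) (by omega)
      have h := sign3_L1I hn hB (w := w) (by omega) (by omega) b1.le b2.le b0
      rw [v2, v3, v5] at h
      have e : (-1 : ℝ) ^ n * (-1) ^ j' = 1 * ((-1) ^ n * 1) * ((-1) ^ n * 1) := by
        rw [hw, pow_add, pow_mul]
        rcases neg_one_pow_eq_or ℝ n with h1 | h1 <;> simp [h1]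
      rw [e]; exact h
    · rw [t3 (by omega) hpar, ← zpow_add₀ hB0.ne']
      obtain ⟨w, hw, hw2⟩ : ∃ w, j' = n + 2 * w - 1 ∧ 2 ≤ w := ⟨(j' - n + 1) / 2, by omega, by omega⟩
      have h := sign3_L1W hn hB (w := w) (by omega) (by omega)
      rw [v3] at h
      have e : (-1 : ℝ) ^ n * (-1) ^ j' = -1 := by
        rw [show j' = 2 * (w - 1) + (n + 1) by omega, pow_add, pow_mul, pow_add]
        rcases neg_one_pow_eq_or ℝ n with h1 | h1 <;> simp [h1]
      have e2 : ((j' : ℤ) + n) = 2 * (n : ℤ) + 2 * w - 1 := by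
        have : (j' : ℤ) = n + 2 * w - 1 := by omega
        linarith
      rw [e, e2]; simpa using h

/-- `(−1)^j · E3 > 0` at the `j`-th level-`2` point `B^{2σ + 2j'' − 1}`, `j = 6n + j''`, `j'' ≤ n + 1`. [folklore] -/
theorem sign_tau3_L2 (hn : 2 ≤ n) (hB : 16 * ((n + 2 : ℕ) : ℝ) ^ 2 ≤ B) (j'' : ℕ) (hj : j'' ≤ n + 1) :
    0 < (-1 : ℝ) ^ (6 * n + j'') * E3 n B (B ^ (2 * (sg n : ℤ) + 2 * (j'' : ℤ) - 1)) := by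
  obtain ⟨hB1, -, -⟩ := hB16 hB
  obtain ⟨-, v2, v3, v4, -⟩ := sign_values (n := n) (by omega)
  have hsq := neg_one_pow_sq' n
  have hn' : (2 : ℤ) ≤ n := by exact_mod_cast hn
  have h6n : (-1 : ℝ) ^ (6 * n + j'') = (-1) ^ j'' := by
    rw [pow_add, show 6 * n = 2 * (3 * n) by ring, pow_mul]; norm_num
  rw [h6n, show (2 * (sg n : ℤ) + 2 * (j'' : ℤ) - 1) = (sg n : ℤ) + ((sg n : ℤ) + 2 * j'' - 1) by ring]
  have hy : 4 * (n : ℤ) + 3 ≤ (sg n : ℤ) + 2 * j'' - 1 := by rw [sg_cast]; linarith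
  rcases Nat.eq_zero_or_pos j'' with h0 | hj0
  · subst h0
    have h := sign3_L2 hn hB hy 0
      (fun l hl => ec_low_dom hn (Nat.one_le_iff_ne_zero.2 fun h => hl (Fin.ext h)) (val_le l) (by rw [sg_cast]; push_cast; linarith))
      (by
        have := gap_mid hn
        have hy0 : (sg n : ℤ) + 2 * ((0 : ℕ) : ℤ) - 1 = 4 * n + 3 := by rw [sg_cast]; push_cast; ring
        rw [hy0]; exact this)
    rw [v2, v3] at h
    have e : (1 * ((-1 : ℝ) ^ n * 1) * ((-1) ^ n * 1)) = ((-1 : ℝ) ^ n) ^ 2 := by ring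
    rw [e, hsq] at h; simpa using h
  · by_cases hjn : j'' ≤ n
    · have hyw : (sg n : ℤ) + 2 * j'' - 1 = 4 * n + 2 * j'' + 3 := by rw [sg_cast]; ring
      have h := sign3_L2 hn hB hy ⟨j'', by omega⟩
        (fun l hl => by rw [hyw]; exact ec_blk_dom hn hj0 hjn (val_le l) (fun h => hl (Fin.ext h)))
        (by rw [hyw]; exact gap_blkC hn hj0 hjn)
      have vj : scF n ⟨j'', by omega⟩ = (-1) ^ j'' := by show scR n j'' = _; rw [scR_blk hj0 hjn]
      rw [v3, vj] at h
      have e : (1 * ((-1 : ℝ) ^ n * 1) * ((-1) ^ n * (-1) ^ j'')) = (-1) ^ j'' * ((-1 : ℝ) ^ n) ^ 2 := by ring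
      rw [e, hsq, mul_one] at h; exact h
    · have hj' : j'' = n + 1 := by omega
      subst hj'
      have hyw : (sg n : ℤ) + 2 * ((n + 1 : ℕ) : ℤ) - 1 = 6 * n + 5 := by rw [sg_cast]; push_cast; ring
      have h := sign3_L2 hn hB hy (Fin.last (n + 1))
        (fun l hl => by
          rw [hyw]
          exact ec_top_dom hn (by
            have := val_le l
            have hne : (l : ℕ) ≠ n + 1 := fun h => hl (Fin.ext (by simp [h]))
            omega))
        (by rw [hyw]; exact gap_top hn)
      rw [v3, v4] at h
      have e : (1 * ((-1 : ℝ) ^ n * 1) * ((-1) ^ n * (-1) ^ (n + 1))) = (-1) ^ (n + 1) * ((-1 : ℝ) ^ n) ^ 2 := by ring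
      rw [e, hsq, mul_one] at h; exact h

/-- **`(−1)^j · E3 > 0` at the `j`-th point**, `j ≤ 7n + 1`. [folklore] -/
theorem sign_tau3 (hn : 2 ≤ n) (hB : 16 * ((n + 2 : ℕ) : ℝ) ^ 2 ≤ B) (j : ℕ) (hj : j ≤ 7 * n + 1) :
    0 < (-1 : ℝ) ^ j * E3 n B (tau3 n B j) := by
  unfold tau3
  by_cases h1 : j < 3 * n
  · rw [if_pos h1]; exact sign_tau3_L0 hn hB j h1
  · rw [if_neg h1]
    by_cases h2 : j < 6 * n
    · rw [if_pos h2]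
      obtain ⟨j', rfl⟩ : ∃ j', j = 3 * n + j' := ⟨j - 3 * n, by omega⟩
      rw [show 3 * n + j' - 3 * n = j' by omega]
      exact sign_tau3_L1 hn hB j' (by omega)
    · rw [if_neg h2]
      obtain ⟨j'', rfl⟩ : ∃ j'', j = 6 * n + j'' := ⟨j - 6 * n, by omega⟩
      rw [show 6 * n + j'' - 6 * n = j'' by omega]
      exact sign_tau3_L2 hn hB j'' (by omega)

/-! ## 3. Monotonicity and positivity of the points -/

/-- the last level-pattern point is `B^{4n−1}`. [folklore] -/
theorem tau_last (hn : 2 ≤ n) : tau n B (3 * n - 1) = B ^ (4 * (n : ℤ) - 1) := by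
  obtain ⟨-, -, t3⟩ := tau_level (B := B) hn (3 * n - 1) (by omega)
  rw [t3 (by omega) (by omega)]
  congr 1
  have : ((3 * n - 1 : ℕ) : ℤ) = 3 * n - 1 := by omega
  rw [this]; ring

/-- the points increase. [folklore] -/
theorem tau3_lt_succ (hn : 2 ≤ n) (hB : 16 * ((n + 2 : ℕ) : ℝ) ^ 2 ≤ B) (j : ℕ) (hj : j + 1 ≤ 7 * n + 1) :
    tau3 n B j < tau3 n B (j + 1) := by
  obtain ⟨hB1, -, hB4⟩ := hB16 hB
  have hB0 : 0 < B := lt_trans zero_lt_one hB1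
  have hn' : (2 : ℤ) ≤ n := by exact_mod_cast hn
  unfold tau3
  by_cases h1 : j + 1 < 3 * n
  · rw [if_pos (by omega), if_pos h1]; exact tau_lt_succ hn hB4 j (by omega)
  · rw [if_neg h1]
    by_cases h1' : j < 3 * n
    · -- j = 3n - 1
      rw [if_pos h1', if_pos (by omega), show j = 3 * n - 1 by omega, tau_last hn, show 3 * n - 1 + 1 - 3 * n = 0 by omega,
        (tau_level (B := B) hn 0 (by omega)).1 (by omega), ← zpow_add₀ hB0.ne']
      exact zpow_lt_zpow_right₀ hB1 (by rw [sg_cast]; push_cast; linarith)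
    · rw [if_neg h1']
      by_cases h2 : j + 1 < 6 * n
      · rw [if_pos (by omega), if_pos h2, show j + 1 - 3 * n = (j - 3 * n) + 1 by omega]
        exact mul_lt_mul_of_pos_left (tau_lt_succ hn hB4 (j - 3 * n) (by omega)) (zpow_pos hB0 _)
      · rw [if_neg h2]
        by_cases h2' : j < 6 * n
        · rw [if_pos h2', show j - 3 * n = 3 * n - 1 by omega, tau_last hn, ← zpow_add₀ hB0.ne']
          exact zpow_lt_zpow_right₀ hB1 (by rw [sg_cast]; nlinarith)
        · rw [if_neg h2']
          exact zpow_lt_zpow_right₀ hB1 (by omega)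

/-- the points are positive. [folklore] -/
theorem tau3_pos (hn : 2 ≤ n) (hB : 16 * ((n + 2 : ℕ) : ℝ) ^ 2 ≤ B) (j : ℕ) : 0 < tau3 n B j := by
  obtain ⟨hB1, -, hB4⟩ := hB16 hB
  have hB0 : 0 < B := lt_trans zero_lt_one hB1
  unfold tau3
  split_ifs
  · exact tau_pos hn hB4 j
  · exact mul_pos (zpow_pos hB0 _) (tau_pos hn hB4 _)
  · exact zpow_pos hB0 _

/-! ## 4. The count and the laws -/

/-- **`7n + 1 = 7K − 13` distinct positive zeros** for the tridiagonal family (`K = n + 2`, `n ≥ 2`, `B ≥ 16K²`). [folklore] -/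
theorem card_posRoots_ge_three (hn : 2 ≤ n) (hB : 16 * ((n + 2 : ℕ) : ℝ) ^ 2 ≤ B) :
    7 * n + 1 ≤ ((∑ l, (X : ℝ[X]) ^ dF n l • (letters3 n B l).map Polynomial.C).det.roots.toFinset.filter
      (fun t => 0 < t)).card := by
  have hB0 : 0 < B := lt_trans zero_lt_one (hB16 hB).1
  refine le_card_posRoots_of_alternating _ (7 * n + 1) (fun j => tau3 n B j)
    (Fin.strictMono_iff_lt_succ.2 fun i => ?_) (fun j => tau3_pos hn hB j) fun j => ?_
  · simpa using tau3_lt_succ hn hB i (by have := i.isLt; omega)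
  · have hj : (j : ℕ) + 1 ≤ 7 * n + 1 := by have := j.isLt; omega
    have h1 := sign_tau3 hn hB j (by omega)
    have h2 := sign_tau3 hn hB (j + 1) hj
    rw [eval_det_letters3 n hB0.ne', eval_det_letters3 n hB0.ne']
    simp only [Fin.val_castSucc, Fin.val_succ]
    have e : (-1 : ℝ) ^ ((j : ℕ) + 1) = -(-1 : ℝ) ^ (j : ℕ) := by rw [pow_succ]; ring
    rw [e] at h2
    have hsq : (-1 : ℝ) ^ (j : ℕ) * (-1 : ℝ) ^ (j : ℕ) = 1 := by rw [← pow_add, ← two_mul, pow_mul]; norm_num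
    nlinarith [mul_pos h1 h2]

/-- **`ζ_sym(3,K) ≥ 7K − 13` for every `K ≥ 4`**: the row `PosRootLawAt 3 K (7K − 14)` is FALSE for every `K ≥ 4`. [folklore] -/
theorem tri_law_three (K : ℕ) (hK : 4 ≤ K) : ¬ PosRootLawAt 3 K (7 * K - 14) := by
  obtain ⟨n, rfl⟩ : ∃ n, K = n + 2 := ⟨K - 2, by omega⟩
  have hn : 2 ≤ n := by omega
  intro h
  have h1 := h (dF n) (letters3 n (16 * ((n + 2 : ℕ) : ℝ) ^ 2)) (letters3_isSymm n _)
  have h2 := card_posRoots_ge_three (B := 16 * ((n + 2 : ℕ) : ℝ) ^ 2) hn le_rfl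
  omega

/-- the same in witness form. [folklore] -/
theorem exists_pencil_three (K : ℕ) (hK : 4 ≤ K) :
    ∃ (d : Fin K → ℕ) (S : Fin K → Matrix (Fin 3) (Fin 3) ℝ), (∀ l, (S l).IsSymm) ∧
      7 * K - 13 ≤ ((∑ l, (X : ℝ[X]) ^ d l • (S l).map Polynomial.C).det.roots.toFinset.filter
        (fun t => 0 < t)).card := by
  obtain ⟨n, rfl⟩ : ∃ n, K = n + 2 := ⟨K - 2, by omega⟩
  refine ⟨dF n, letters3 n (16 * ((n + 2 : ℕ) : ℝ) ^ 2), letters3_isSymm n _, ?_⟩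
  have h2 := card_posRoots_ge_three (B := 16 * ((n + 2 : ℕ) : ℝ) ^ 2) (by omega) le_rfl
  omega

/-- **The RAIL FLOOR at `m = 3` holds**: `ζ_sym(3,K) ≥ 6K − 9` for every `K ≥ 3` (`KPlusLogSqLaw.RailLaw.RailFloorThree`, the cell
conjecture of pub-symmetroid theory-2 g19; `K = 3` from the census row `(3,3) = 9`, `K ≥ 4` from `tri_law_three` since
`7K − 14 ≥ 6K − 10`). [folklore] -/
theorem railFloorThree_holds : KPlusLogSqLaw.RailLaw.RailFloorThree := by
  intro K hK
  by_cases h3 : K = 3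
  · subst h3; exact KPlusLogSqLaw.RailLaw.railFloorThree_upto_ten 3 le_rfl (by norm_num)
  · intro h
    exact tri_law_three K (by omega) (fun d S hS => le_trans (h d S hS) (by omega))

end Summit.ValiantsHypothesis.ValiantsHypothesis.Theorems.LacunarySymmetroidMatrixDescartes.VSQ
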